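import Mathlib.Algebra.BigOperators.Group.Finset.Basic
import Mathlib.Algebra.Ring.Parity
import Mathlib.Data.ZMod.Basic
import Mathlib.Data.Int.GCD
import Mathlib.RingTheory.Int.Basic
import Mathlib.Tactic.Linarith
import Mathlib.Tactic.NormNum
import Mathlib.Tactic.Ring
import Mathlib.Tactic.IntervalCases
import Mathlib.Tactic.LinearCombination
import HarnessLib

/-!
# The (0,1) cell of the ι-window, XVI: the product ground `B₁ × B₂`, III — the ARITHMETIC of ALL two-term box types (no window),
# the eigen-Euler pairing, LEMMA M1 (filtered deformations), the virtual dimension of the cell — algebraic skeleton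

Family `hodge`, b2b cell `hweil` (helper of item stmt-HodgeConjecture-2524). Report
`run/shared/lean/b2b/hodge-weil/b2b-hweil-pv1-g28/H2-ZERO-ONE-16.md` (prover 1 gen 28). Companion to `WeilTypeLadderH2ProductGroundTwo.lean`
(gen 27: LEMMA FB, the Eisenstein parametrisation, THEOREM PB2, `pgt_*`). HONEST FRAMING: census results inside the ladder's H2 test ((0,1) cell)
on the SPECIAL fourfold `X₀ = B₁ × B₂`; by the cell's THEOREM U5 an object there would decide H2 positively, emptiness of a family there is a census
line and nothing more. No case of the Hodge conjecture is proved; nothing here is a rung; no statement of [Markman 2025] / [Perry 2026] / [EdGFS 2025]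
is used. The kernel content is the elementary arithmetic of the report; the geometry (holomorphic Lefschetz, Mukai, Serre duality, Künneth, the
filtered deformation functor) is quoted print and the cell's certified items.

## LEMMA AK (report §1): the two-term types, all windows

In reading `W` a class of the secant plane is `u = (r, c, c − r)` with `u² = 2N(u)`, `N(u) = r² − rc + c²` (an Eisenstein norm), and the Mukai pairing
of two such classes IS the Eisenstein bilinear form: `⟨u,u'⟩ = 2rr' − rc' − r'c + 2cc'` (`pg3_pairing_is_eisenstein`). By [15] 2.3 every two-term
decomposition comes from a pair `(u₂, u₂')` of area `k = r₂c₂' − c₂r₂'` with `(2/k)·(rotated conjugates)` integral; integrality forces `k ∣ 4`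
(`pg3_area_divides_four`, `pg3_area_values`): ONLY `|k| ∈ {1, 2, 4}` occur. The Lagrange identity `⟨u,u'⟩² + 3k² = 4N(u)N(u')`
(`pg3_lagrange_identity`) then classifies the norm patterns: `|k| = 2`: `[M,N,N,M]` with `MN = b² + 3`, `⟨u₂,u₂'⟩ = 2b` (`pg3_type_F2`); `|k| = 1`:
`[4M,N,4N,M]` with `MN = b² + b + 1` (`pg3_type_F1`); `|k| = 4`: `MN = b² + 12`, `⟨,⟩ = 2b` (`pg3_type_F4`). CROSS types (`[1,N,N,1]`, `|k| = 2`) exist iff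
`N = e² + 3`, and the big factor has rank `±2` against a curve-type unit and rank `e ± 1` against an ideal-type unit (`pg3_cross_curve`, `pg3_cross_ideal`,
`pg3_cross_idealtheta`); with `t(big) = μ·t(unit)` LEMMA FB gives `e₁^ι(big) = e² + 5 − 3μ²`, which is `≡ 2 (mod 4)` (`pg3_cross_e_mod_four`): a RIGID big
factor (`e₁ = 0`) never occurs (`pg3_no_rigid_cross`, more generally `pg3_cross_e_not_mult_four`), `e₁ = 10` never occurs (`pg3_cross_e_ne_ten`),
`e₁ = 2` iff `μ² = 3d² + 1`, `c = 3d` (`pg3_cross_e_two`; first cases `pg3_pell_solutions`: `N ∈ {3, 12, 147, 2028, …}`), and `μ ∣ 2` in every cross type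
whose big class is `μ`·(norm-3 class) (`pg3_mu_divides_two`). Consequences for [15]'s residual R-PB2′: (b) norm 25 forces `5 ∣ r, 5 ∣ c` hence `5 ∣ k`,
impossible (`pg3_norm25_classes`, `pg3_rpb2b_void`); (a) the rank-4 norm-12 class `(4,2,−2)` pairs only with IDEAL-type units (`pg3_rpb2a_partner`), so
`|t_w| = 6 > 4` forces a singularity at the shared half-period.

## LEMMA EE, LEMMA M1, PROPOSITION VD1 (report §§2–4)

`pg3_eigen_euler`: `χ^± = ½(χ ± T/4)` from `χ⁺ + χ⁻ = χ` and `χ⁺ − χ⁻ = T/4` (holomorphic Lefschetz on a surface); `pg3_eigen_kunneth`: the fourfold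
eigen-pairing of box objects. `pg3_m1_bound`: the arithmetic of LEMMA M1 (`e₁^ι(F) ≥ ext¹(B,A)^s − 1 + max(0, m − rank d)`). `pg3_virtual_dimension_one`:
at every ι-invariant simple `F` with H2 numerics (`t ≡ 0`, `e₂^ι = 10 + 2e₁^ι`, `rank σ^ι = 12 + r`) the tangent-minus-half-obstruction count is `1`.
`pg3_thirteen_four_pairing`: the pairing `14` behind the correction of [15] (III) `[4,13,13,4]` (crude count `12 − 15 < 2`).
-/

-- mandated namespace `Summit.HodgeConjecture.HodgeConjecture.…` (Problem = Summit) trips `linter.dupNamespace`; the lakefile disables it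
-- tree-wide (weak option), restated here so stand-alone elaboration is warning-free too.
set_option linter.dupNamespace false

namespace Summit.HodgeConjecture.HodgeConjecture.WeilTypeLadder

section ProductGroundThree

/-! ### LEMMA AK — the arithmetic of the Eisenstein parametrisation (report §1) -/

/-- **Area divides four (report §1.1).** In [15] 2.3 the B₁-classes are `(2/k)·(−r₂', c₂'−r₂', c₂')` and `(2/k)·(r₂, r₂−c₂, −c₂)` with
`k = r₂c₂' − c₂r₂'`; their integrality means `k ∣ 2r₂', k ∣ 2c₂', k ∣ 2r₂, k ∣ 2c₂`, whence `k² ∣ 4(r₂c₂' − c₂r₂') = 4k` and `k ∣ 4`. [new, elementary] -/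
theorem pg3_area_divides_four (k a b c d : ℤ) (hk : k = a * d - b * c) (hk0 : k ≠ 0)
    (ha : k ∣ 2 * a) (hb : k ∣ 2 * b) (hc : k ∣ 2 * c) (hd : k ∣ 2 * d) : k ∣ 4 := by
  obtain ⟨p, hp⟩ := ha
  obtain ⟨u, hu⟩ := hb
  obtain ⟨v, hv⟩ := hc
  obtain ⟨q, hq⟩ := hd
  have e1 : (2 * a) * (2 * d) - (2 * b) * (2 * c) = 4 * k := by rw [hk]; ring
  rw [hp, hu, hv, hq] at e1
  have key : k * (k * (p * q - u * v)) = k * 4 := by linear_combination e1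
  have h2 : k * (p * q - u * v) = 4 := mul_left_cancel₀ hk0 key
  exact ⟨p * q - u * v, h2.symm⟩

/-- **Only `|k| ∈ {1,2,4}` (report §1.1).** A non-zero integer dividing `4` is `±1, ±2, ±4` (`±3` does not divide `4`). Hence the two-term types
of the H2 class fall into three arithmetic families F1 (`|k| = 1`), F2 (`|k| = 2`), F4 (`|k| = 4`, the mirror of F1). [new, elementary] -/
theorem pg3_area_values (k : ℤ) (h : k ∣ 4) (hk0 : k ≠ 0) :
    k = 1 ∨ k = -1 ∨ k = 2 ∨ k = -2 ∨ k = 4 ∨ k = -4 := by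
  have h1 : k ≤ 4 := Int.le_of_dvd (by norm_num) h
  have h2 : -k ≤ 4 := Int.le_of_dvd (by norm_num) (Int.neg_dvd.mpr h)
  have h3 : -4 ≤ k := by linarith
  obtain ⟨m, hm⟩ := h
  interval_cases k <;> omega

/-- **The Mukai pairing on the secant plane is the Eisenstein bilinear form (report §1.2).** For `u = (r, c, c − r)`, `u' = (r', c', c' − r')`:
`⟨u,u'⟩ = 2cc' − r s' − r' s = 2rr' − rc' − r'c + 2cc'` (twice the polar form of `r² − rc + c²`). [new, elementary] -/
theorem pg3_pairing_is_eisenstein (r c r' c' : ℤ) :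
    2 * c * c' - r * (c' - r') - r' * (c - r) = 2 * r * r' - r * c' - r' * c + 2 * c * c' := by
  ring

/-- **Lagrange identity for the Eisenstein form (report §1.2).** `⟨u,u'⟩² + 3k² = 4·N(u)·N(u')` with `k` the area: the norm form `r² − rc + c²` has
discriminant `−3`. This ties the Mukai pairing of the two factors on one surface to their norms and the area. [new, elementary] -/
theorem pg3_lagrange_identity (r c r' c' : ℤ) :
    (2 * r * r' - r * c' - r' * c + 2 * c * c') ^ 2 + 3 * (r * c' - c * r') ^ 2 =
      4 * (r ^ 2 - r * c + c ^ 2) * (r' ^ 2 - r' * c' + c' ^ 2) := by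
  ring

/-- **Family F2, `|k| = 2` (report §1.3): `N(u₂)N(u₂') = b² + 3` and `⟨u₂,u₂'⟩ = 2b`.** (`k` even makes `rc' + r'c` even, so the pairing is even;
then Lagrange with `k² = 4`.) The norm pattern of the type is `[M,N,N,M]` (`M = N(u₂')`, `N = N(u₂)`); CROSS types are the case `M = 1`: `N = b² + 3`.
[new, elementary] -/
theorem pg3_type_F2 (r c r' c' : ℤ) (hk : r * c' - c * r' = 2 ∨ r * c' - c * r' = -2) :
    ∃ b : ℤ, (r ^ 2 - r * c + c ^ 2) * (r' ^ 2 - r' * c' + c' ^ 2) = b ^ 2 + 3 ∧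
      2 * r * r' - r * c' - r' * c + 2 * c * c' = 2 * b := by
  have lag := pg3_lagrange_identity r c r' c'
  rcases hk with h | h
  · refine ⟨r * r' + c * c' - c * r' - 1, ?_, ?_⟩
    · have hb : 2 * r * r' - r * c' - r' * c + 2 * c * c' = 2 * (r * r' + c * c' - c * r' - 1) := by linear_combination (-1 : ℤ) * h
      rw [hb, h] at lag
      exact mul_left_cancel₀ (by norm_num : (4 : ℤ) ≠ 0) (by linear_combination (-1 : ℤ) * lag)
    · linear_combination (-1 : ℤ) * h
  · refine ⟨r * r' + c * c' - c * r' + 1, ?_, ?_⟩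
    · have hb : 2 * r * r' - r * c' - r' * c + 2 * c * c' = 2 * (r * r' + c * c' - c * r' + 1) := by linear_combination (-1 : ℤ) * h
      rw [hb, h] at lag
      exact mul_left_cancel₀ (by norm_num : (4 : ℤ) ≠ 0) (by linear_combination (-1 : ℤ) * lag)
    · linear_combination (-1 : ℤ) * h

/-- **Family F1, `|k| = 1` (report §1.3): `N(u₂)N(u₂') = b² + b + 1`** (the pairing `2b + 1` is odd). The norm pattern is `[4M, N, 4N, M]`; the parallel
type `[4,1,4,1]` and the one-unit types `[4M,1,4,M]`, `[4,N,4N,1]` are its cases `MN = 1`, `M = 1`, `N = 1`. [new, elementary] -/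
theorem pg3_type_F1 (r c r' c' : ℤ) (hk : r * c' - c * r' = 1 ∨ r * c' - c * r' = -1) :
    ∃ b : ℤ, (r ^ 2 - r * c + c ^ 2) * (r' ^ 2 - r' * c' + c' ^ 2) = b ^ 2 + b + 1 ∧
      2 * r * r' - r * c' - r' * c + 2 * c * c' = 2 * b + 1 := by
  have lag := pg3_lagrange_identity r c r' c'
  rcases hk with h | h
  · refine ⟨r * r' + c * c' - c * r' - 1, ?_, ?_⟩
    · have hb : 2 * r * r' - r * c' - r' * c + 2 * c * c' = 2 * (r * r' + c * c' - c * r' - 1) + 1 := by linear_combination (-1 : ℤ) * h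
      rw [hb, h] at lag
      exact mul_left_cancel₀ (by norm_num : (4 : ℤ) ≠ 0) (by linear_combination (-1 : ℤ) * lag)
    · linear_combination (-1 : ℤ) * h
  · refine ⟨r * r' + c * c' - c * r', ?_, ?_⟩
    · have hb : 2 * r * r' - r * c' - r' * c + 2 * c * c' = 2 * (r * r' + c * c' - c * r') + 1 := by linear_combination (-1 : ℤ) * h
      rw [hb, h] at lag
      exact mul_left_cancel₀ (by norm_num : (4 : ℤ) ≠ 0) (by linear_combination (-1 : ℤ) * lag)
    · linear_combination (-1 : ℤ) * h

/-- **Family F4, `|k| = 4` (report §1.3): `N(u₂)N(u₂') = b² + 12`, `⟨u₂,u₂'⟩ = 2b`** (the mirror of F1 under `B₁ ↔ B₂`: both norms are divisible by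
`4` and `b` is even, `MN = (b/2)² + 3·1` with … — only the identity is recorded). [new, elementary] -/
theorem pg3_type_F4 (r c r' c' : ℤ) (hk : r * c' - c * r' = 4 ∨ r * c' - c * r' = -4) :
    ∃ b : ℤ, (r ^ 2 - r * c + c ^ 2) * (r' ^ 2 - r' * c' + c' ^ 2) = b ^ 2 + 12 ∧
      2 * r * r' - r * c' - r' * c + 2 * c * c' = 2 * b := by
  have lag := pg3_lagrange_identity r c r' c'
  rcases hk with h | h
  · refine ⟨r * r' + c * c' - c * r' - 2, ?_, ?_⟩
    · have hb : 2 * r * r' - r * c' - r' * c + 2 * c * c' = 2 * (r * r' + c * c' - c * r' - 2) := by linear_combination (-1 : ℤ) * h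
      rw [hb, h] at lag
      exact mul_left_cancel₀ (by norm_num : (4 : ℤ) ≠ 0) (by linear_combination (-1 : ℤ) * lag)
    · linear_combination (-1 : ℤ) * h
  · refine ⟨r * r' + c * c' - c * r' + 2, ?_, ?_⟩
    · have hb : 2 * r * r' - r * c' - r' * c + 2 * c * c' = 2 * (r * r' + c * c' - c * r' + 2) := by linear_combination (-1 : ℤ) * h
      rw [hb, h] at lag
      exact mul_left_cancel₀ (by norm_num : (4 : ℤ) ≠ 0) (by linear_combination (-1 : ℤ) * lag)
    · linear_combination (-1 : ℤ) * h

/-- **CROSS law, curve-type partner (report §1.4).** If the unit on the big factor's surface is the curve class `(0, 1, 1)` (`𝒪_{C_κ}(Kξ)`-type),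
the area condition `k = r·1 − c·0 = ±2` says the big factor `(r, c, c − r)` has RANK `±2`, and its norm is `(c ∓ 1)² + 3`. [new, elementary] -/
theorem pg3_cross_curve (r c : ℤ) (h : r * 1 - c * 0 = 2 ∨ r * 1 - c * 0 = -2) :
    ∃ e : ℤ, r ^ 2 - r * c + c ^ 2 = e ^ 2 + 3 ∧ r ^ 2 = 4 := by
  rcases h with h | h
  · exact ⟨c - 1, by nlinarith [h], by nlinarith [h]⟩
  · exact ⟨c + 1, by nlinarith [h], by nlinarith [h]⟩

/-- **CROSS law, ideal-type partner `𝓘_w` (report §1.4).** Against the unit class `(1, 0, −1)` the area condition is `k = r·0 − c·1 = ±2`, i.e.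
`c = ∓2`, and then `N = r² ∓ 2r + 4 = (r ∓ 1)² + 3`: the big factor has rank `e ± 1` where `N = e² + 3`. [new, elementary] -/
theorem pg3_cross_ideal (r c : ℤ) (h : r * 0 - c * 1 = 2 ∨ r * 0 - c * 1 = -2) :
    ∃ e : ℤ, r ^ 2 - r * c + c ^ 2 = e ^ 2 + 3 ∧ (r - e) ^ 2 = 1 := by
  rcases h with h | h
  · exact ⟨r + 1, by nlinarith [h], by nlinarith [h]⟩
  · exact ⟨r - 1, by nlinarith [h], by nlinarith [h]⟩

/-- **CROSS law, ideal-type partner `𝓘_w(Θ_κ)` (report §1.4).** Against the unit class `(1, 1, 0)` the area condition is `k = r − c = ±2`, and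
`N = (r − c)² + rc = 4 + r(r ∓ 2) = (r ∓ 1)² + 3`: again rank `e ± 1` with `N = e² + 3`. Together with `pg3_cross_curve`/`pg3_cross_ideal`: cross types
exist exactly for the norms `N = e² + 3` (`3, 4, 7, 12, 19, 28, 39, 52, …`), and never for `13, 25, 73, 241`. [new, elementary] -/
theorem pg3_cross_idealtheta (r c : ℤ) (h : r * 1 - c * 1 = 2 ∨ r * 1 - c * 1 = -2) :
    ∃ e : ℤ, r ^ 2 - r * c + c ^ 2 = e ^ 2 + 3 ∧ (r - e) ^ 2 = 1 := by
  rcases h with h | h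
  · exact ⟨r - 1, by nlinarith [h], by nlinarith [h]⟩
  · exact ⟨r + 1, by nlinarith [h], by nlinarith [h]⟩

/-- **The invariant dimension of a cross-type big factor is `≡ 2 (mod 4)` (report §1.5).** With `N = c² + 3` and `t(big) = μ·t(unit)` (t-separation,
[15] 3.3) LEMMA FB gives `e₁^ι(big) = 2 + N − 3μ² = c² + 5 − 3μ²`, an even number; parity of `c, μ` then forces `e₁^ι ≡ 2 (mod 4)`. In particular
`e₁^ι(big) ∉ {0, 4, 8, 12, 16, …}`: NO cross type has a rigid big factor. [new, elementary] -/
theorem pg3_cross_e_mod_four (c μ e : ℤ) (he : e = c ^ 2 + 5 - 3 * μ ^ 2) (hev : Even e) : e % 4 = 2 := by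
  obtain ⟨t, ht⟩ := hev
  rcases Int.even_or_odd c with ⟨a, ha⟩ | ⟨a, ha⟩ <;> rcases Int.even_or_odd μ with ⟨b, hb⟩ | ⟨b, hb⟩
  · have hz : ∃ z : ℤ, e = 4 * z + 5 := ⟨a ^ 2 - 3 * b ^ 2, by rw [he, ha, hb]; ring⟩
    obtain ⟨z, hz⟩ := hz
    omega
  · have hz : ∃ z : ℤ, e = 4 * z + 2 := ⟨a ^ 2 - 3 * b ^ 2 - 3 * b, by rw [he, ha, hb]; ring⟩
    obtain ⟨z, hz⟩ := hz
    omega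
  · have hz : ∃ z : ℤ, e = 4 * z + 6 := ⟨a ^ 2 + a - 3 * b ^ 2, by rw [he, ha, hb]; ring⟩
    obtain ⟨z, hz⟩ := hz
    omega
  · have hz : ∃ z : ℤ, e = 4 * z + 3 := ⟨a ^ 2 + a - 3 * b ^ 2 - 3 * b, by rw [he, ha, hb]; ring⟩
    obtain ⟨z, hz⟩ := hz
    omega

/-- **No cross type has `e₁^ι(big)` divisible by `4` (report §1.5)** — in particular no RIGID big factor (`e₁ = 0`) and no `e₁ ∈ {4, 8, 12, 16}`.
[new, elementary; corollary of `pg3_cross_e_mod_four`] -/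
theorem pg3_cross_e_not_mult_four (c μ n : ℤ) : c ^ 2 + 5 - 3 * μ ^ 2 ≠ 4 * n := by
  intro h
  have := pg3_cross_e_mod_four c μ (4 * n) h.symm ⟨2 * n, by ring⟩
  omega

/-- **All-rigid cross types do not exist (report §1.5, R-PB2′ (b)/(c) of [15] are empty).** `c² + 5 = 3μ²` has no integer solution. [new, elementary] -/
theorem pg3_no_rigid_cross (c μ : ℤ) : c ^ 2 + 5 ≠ 3 * μ ^ 2 := by
  intro h
  have := pg3_cross_e_not_mult_four c μ 0
  exact this (by linarith)

/-- **`e₁^ι(big) = 10` never occurs in a cross type (report §1.5):** `c² − 3μ² = 5` is impossible modulo `3` (`c² ≡ 2`). So the admissible values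
begin `2, 6, 14, 18, …`. [new, elementary] -/
theorem pg3_cross_e_ne_ten (c μ : ℤ) : c ^ 2 + 5 - 3 * μ ^ 2 ≠ 10 := by
  intro h
  have h3 : ((c ^ 2 + 5 - 3 * μ ^ 2 : ℤ) : ZMod 3) = ((10 : ℤ) : ZMod 3) := by rw [h]
  push_cast at h3
  revert h3
  generalize (c : ZMod 3) = x
  generalize (μ : ZMod 3) = y
  revert x y
  decide

/-- **The `e₁^ι = 2` series of cross types (report §1.5).** `c² + 5 − 3μ² = 2` forces `3 ∣ c`, `c = 3d`, and the Pell equation `μ² = 3d² + 1`; the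
big class is then `μ`·(a norm-3 class) with `N = 3μ²`. [new, elementary] -/
theorem pg3_cross_e_two (c μ : ℤ) (h : c ^ 2 + 5 - 3 * μ ^ 2 = 2) : ∃ d : ℤ, c = 3 * d ∧ μ ^ 2 = 3 * d ^ 2 + 1 := by
  have h3 : (3 : ℤ) ∣ c ^ 2 := ⟨μ ^ 2 - 1, by linarith⟩
  obtain ⟨d, hd⟩ := Int.prime_three.dvd_of_dvd_pow h3
  refine ⟨d, hd, ?_⟩
  rw [hd] at h
  nlinarith [h]

/-- **The Pell solutions that occur (report §1.5).** `x² = 3y² + 1` for `(x, y) = (1,0), (2,1), (7,4), (26,15)`: as `(μ, d)` they give the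
`e₁^ι = 2` cross series `N = 3μ² ∈ {3, 12, 147, 2028}` (= `c² + 3` with `c = 3d ∈ {0, 3, 12, 45}`), and as `(c, μ)` the `e₁^ι = 6` series
`N = c² + 3 ∈ {7, 52, 679}` (`μ = 1, 4, 15`); the first members of the `e₁^ι = 14, 18` series are `(c, μ) = (6, 3)` (`N = 39`) and `(4, 1)` (`N = 19`).
[new; bookkeeping] -/
theorem pg3_pell_solutions :
    (1 : ℤ) ^ 2 = 3 * 0 ^ 2 + 1 ∧ (2 : ℤ) ^ 2 = 3 * 1 ^ 2 + 1 ∧ (7 : ℤ) ^ 2 = 3 * 4 ^ 2 + 1 ∧ (26 : ℤ) ^ 2 = 3 * 15 ^ 2 + 1 ∧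
    (3 : ℤ) * 1 ^ 2 = 0 ^ 2 + 3 ∧ (3 : ℤ) * 2 ^ 2 = 3 ^ 2 + 3 ∧ (3 : ℤ) * 7 ^ 2 = 12 ^ 2 + 3 ∧ (3 : ℤ) * 26 ^ 2 = 45 ^ 2 + 3 ∧
    (2 : ℤ) ^ 2 + 5 - 3 * 1 ^ 2 = 6 ∧ (7 : ℤ) ^ 2 + 5 - 3 * 4 ^ 2 = 6 ∧ (26 : ℤ) ^ 2 + 5 - 3 * 15 ^ 2 = 6 ∧
    (6 : ℤ) ^ 2 + 5 - 3 * 3 ^ 2 = 14 ∧ (4 : ℤ) ^ 2 + 5 - 3 * 1 ^ 2 = 18 := by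
  norm_num

/-- **In a cross type whose big class is `μ`·(norm-3 class), `μ ∣ 2` (report §1.5).** The area of `μ·n₃` with a unit is `μ`·(area of `n₃` with the
unit) `= ±2`; so `μ ≥ 3` is impossible — the `e₁^ι = 2` series reduces to `N ∈ {3, 12}` ([15] (II₃) and (V)/R-PB2′ (a)). [new, elementary] -/
theorem pg3_mu_divides_two (μ a : ℤ) (h : μ * a = 2 ∨ μ * a = -2) (hμ : 3 ≤ μ) : False := by
  have hd : μ ∣ 2 := by
    rcases h with h | h
    · exact ⟨a, h.symm⟩
    · exact ⟨-a, by linarith⟩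
  have := Int.le_of_dvd (by norm_num) hd
  omega

/-- **R-PB2′ (b) is empty (report §1.6).** A class of Eisenstein norm `25` on the secant plane is `5`·(unit): `r² − rc + c² = 25 ⟹ 5 ∣ r ∧ 5 ∣ c`
(`−3` is not a square mod `5`, so the norm form is anisotropic over `𝔽₅`). [new, elementary] -/
theorem pg3_norm25_classes (r c : ℤ) (h : r ^ 2 - r * c + c ^ 2 = 25) : (5 : ℤ) ∣ r ∧ (5 : ℤ) ∣ c := by
  have h5 : ((r ^ 2 - r * c + c ^ 2 : ℤ) : ZMod 5) = ((25 : ℤ) : ZMod 5) := by rw [h]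
  push_cast at h5
  have key : ∀ x y : ZMod 5, x ^ 2 - x * y + y ^ 2 = 25 → x = 0 ∧ y = 0 := by decide
  obtain ⟨hr, hc⟩ := key _ _ h5
  exact ⟨(ZMod.intCast_zmod_eq_zero_iff_dvd r 5).mp hr, (ZMod.intCast_zmod_eq_zero_iff_dvd c 5).mp hc⟩

/-- **R-PB2′ (b) is empty, conclusion (report §1.6).** A norm-25 big factor would need area `±2` with a unit, but `5 ∣ r, 5 ∣ c` makes every area
`rc' − cr'` divisible by `5`. (The same argument with `pg3_no_rigid_cross` empties R-PB2′ (c): no all-rigid cross type exists for any `μ`.)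
[new, elementary] -/
theorem pg3_rpb2b_void (r c r' c' : ℤ) (h : r ^ 2 - r * c + c ^ 2 = 25)
    (hk : r * c' - c * r' = 2 ∨ r * c' - c * r' = -2) : False := by
  obtain ⟨⟨p, hp⟩, ⟨q, hq⟩⟩ := pg3_norm25_classes r c h
  subst hp
  subst hq
  rcases hk with hk | hk
  · have h5 : (5 : ℤ) ∣ 2 := ⟨p * c' - q * r', by linarith⟩
    omega
  · have h5 : (5 : ℤ) ∣ 2 := ⟨-(p * c' - q * r'), by linarith⟩
    omega

/-- **R-PB2′ (a): the partners of the rank-4 norm-12 class are ideal-type (report §1.6).** For `u₂ = (4, 2, −2)` the area with a unit `(r', c', ·)` is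
`4c' − 2r' = ±2`, i.e. `2c' − r' = ±1`: the curve units `(0, ±1, ·)` are excluded, the partners are `𝓘_w`- or `𝓘_w(Θ)`-type. Then t-separation gives
`|t_w(big)| = 3μ = 6 > 4 = rank`: the big factor is NOT locally free at the shared half-period (against [15] 4.3 (V′)'s description). [new, elementary] -/
theorem pg3_rpb2a_partner (r' c' : ℤ) (hk : 4 * c' - 2 * r' = 2 ∨ 4 * c' - 2 * r' = -2) :
    ¬ (r' = 0 ∧ (c' = 1 ∨ c' = -1)) ∧ (3 : ℤ) * 2 > 4 := by
  refine ⟨?_, by norm_num⟩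
  rintro ⟨hr, hc | hc⟩ <;> omega

/-! ### LEMMA EE (eigen-Euler pairing), LEMMA M1, PROPOSITION VD1, and one correction (report §§2–4) -/

/-- **LEMMA EE (eigen-Euler pairing; report §2.1).** For ι-linearised `X, Y` on an abelian surface, `χ⁺ + χ⁻ = χ(X,Y)` and (holomorphic Lefschetz for
`R𝓗om(X,Y)`, local supertrace `t_x(X)t_x(Y)`, `det(1 − dι) = 4`) `χ⁺ − χ⁻ = T/4` with `T = Σ_x t_x(X)t_x(Y)`; hence `χ^± = ½(χ ± T/4)` (on the fourfold:
`T/16`). [new as a tool; the inputs are the cell's certified Lefschetz items] -/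
theorem pg3_eigen_euler (chi T chip chim : ℚ) (h1 : chip + chim = chi) (h2 : chip - chim = T / 4) :
    chip = (chi + T / 4) / 2 ∧ chim = (chi - T / 4) / 2 := by
  constructor <;> linarith

/-- **Eigen-Künneth (report §2.1).** For box objects `A = A₁ ⊠ A₂`, `B = B₁ ⊠ B₂`: `χ^s(B,A) = Σ_σ χ^σ(B₁,A₁)·χ^{sσ}(B₂,A₂) = ½(χ₁χ₂ + s·(T₁/4)(T₂/4))`
— written for `s = +1` with `a = χ₁, b = T₁/4, c = χ₂, d = T₂/4`. [new, elementary] -/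
theorem pg3_eigen_kunneth (a b c d : ℚ) :
    ((a + b) / 2) * ((c + d) / 2) + ((a - b) / 2) * ((c - d) / 2) = (a * c + b * d) / 2 := by
  ring

/-- **LEMMA M1, the arithmetic (report §2.3).** Filtered ι-equivariant first-order deformations of `0 → A → F → B → 0` inject into `Ext¹(F,F)^ι` when
`Hom(A,B) = 0` and form a space of dimension `(ext¹(B,A)^s − 1) + dim ker d`, `d : Ext¹(A,A)^ι ⊕ Ext¹(B,B)^ι → Ext²(B,A)^s`, `(a,b) ↦ a∘e − e∘b`; with
`dim ker d ≥ m − rank d ≥ m − rk` (`rk` any upper bound for the rank) this gives both `e₁^ι(F) ≥ g − 1` (EXT-BOUND) and `e₁^ι(F) ≥ g − 1 + (m − rk)`.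
[new; the deformation theory is standard, only the bookkeeping is checked] -/
theorem pg3_m1_bound (e1F filt g kerd m rk : ℤ) (hinj : filt ≤ e1F) (hfilt : filt = (g - 1) + kerd)
    (hker : m - rk ≤ kerd) (hk0 : 0 ≤ kerd) : g - 1 ≤ e1F ∧ g - 1 + (m - rk) ≤ e1F := by
  constructor <;> omega

/-- **PROPOSITION VD1, the arithmetic (report §4).** At a simple ι-invariant `F` with the H2 numerics (`t ≡ 0`, so `e₂^ι = 10 + 2e₁^ι`) let `12 + r` be
the rank of `σ^ι` (`r = dim ob(ann v) ≥ 0`); the obstruction space `O = ker σ^ι` has dimension `e₂^ι − 12 − r = 2e₁^ι − 2 − r`, its Serre form has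
radical of dimension `r`, so `half := ½(dim O − r) = e₁^ι − 1 − r` and the tangent-minus-obstruction count `e₁^ι − (half + r)` equals `1` for EVERY such
`F`: the ι-equivariant H2 moduli problem is virtually a curve everywhere. [new; reading of the cell's certified identities] -/
theorem pg3_virtual_dimension_one (e1 e2 r dimO half : ℤ) (he2 : e2 = 10 + 2 * e1) (hO : dimO = e2 - (12 + r))
    (hhalf : 2 * half = dimO - r) : e1 - (half + r) = 1 ∧ dimO = 2 * e1 - 2 - r := by
  constructor <;> omega

/-- **Correction to [15] (III) for the type `[4,13,13,4]` (report §3.4).** The area-2 pair `u₂ = (4, 3, −1)` (norm 13), `u₂' = (2, 2, 0)` (norm 4) has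
Mukai pairing `14` (= `2b`, `b = 7`, `4·13 = 7² + 3`), so a Hom/Ext¹ degeneracy condition between these factors has crude codimension bound `1 + 14 = 15`,
and the crude count `12 − 15` does NOT reach `2`; the family is nevertheless void by the eigen-splitting of §3 (pointwise bound ≥ 3). [new; bookkeeping] -/
theorem pg3_thirteen_four_pairing :
    2 * 3 * 2 - 4 * 0 - 2 * (-1 : ℤ) = 14 ∧ (4 : ℤ) * 13 = 7 ^ 2 + 3 ∧ (4 : ℤ) * 2 - 3 * 2 = 2 ∧ (12 : ℤ) - (1 + 14) < 2 := by
  norm_num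

end ProductGroundThree

end Summit.HodgeConjecture.HodgeConjecture.WeilTypeLadder
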